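import Summits.QuantumFields.YangMills.Theorems.BalabanUVNodesN15KingModelAnalyticBlockField
import Summits.QuantumFields.YangMills.Theorems.BalabanUVNodesN15KingModelCovariantBlockFieldCovariance
import HarnessLib

/-!
# BalabanUVNodes ∕ N15 — THE KING-MODEL RUNG (PART Ϫ-a): THE BLOCK-FIELD COVARIANCE CONTINUED — WOODBURY AT TWO-SIDED COMPLEX LINK FIELDS: `C(U,V) := a⁻¹·1 + Q(U)·B(U,V)⁻¹·Q♯_K(V)`
# (`B(U,V) = −cΔ_{U,V} + m²` = PART Ϩ-a's `A(U,V)` AT ZERO BLOCK COUPLING) INVERTS KING's CONTINUED EFFECTIVE LAPLACIAN `Δ_eff(U,V) = a·1 − a²Q(U)A(U,V)⁻¹Q♯_K(V)` (PART Ϩ-l) WHEREVER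
# `A(U,V)` AND `B(U,V)` ARE INVERTIBLE — so NE2's UNIT LAYER `(Δ_eff)⁻¹` in the complex window IS the continued sandwich of PARTS Ϩ-l∕Ϩ-m at `a = 0` plus block-spin noise
# (Track A, DAG node N15 = NE2; FAN-OUT v1.1 §N15 s3 «KING-MODEL RUNG … + what the curved case adds»; count-neutral)

HONEST FRAMING.  Count-neutral (cell `pub-ymgap`, seat `pub-ymgap-dag-n15-e` g52; `--supports stmt-QuantumFields-27247 --as helper` = K3ᴬ, KEY MAP v3).  King's one-level comparison model
([King1986] (2.14) p.653 with Bałaban's one-level covariant block mean (3.19) along a tree contour system, any fibre `𝕜ⁿ`), two-sided complex link fields `(U,V)` as in PARTS Ϛ∕Ϩ.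
This file is ALGEBRA: the dual Woodbury identity for `a·1 − a²XA⁻¹Y`, `A = B + a·YX`, at every pair of complex fields where both inverses exist, and the slices (`V = Uᴴ`: PART Ϥ-k's
real Woodbury form BY NAME; `V = U⁻¹` at unitary `U`).  The window (where the hypotheses hold) is the successor file.  NOT Bałaban's multi-level `C^{(k)}`; NOT a node discharge
(N15 of record untouched); nothing continuum ∕ ℝ⁴ ∕ OS ∕ Clay.

THE RESULTS (`T` a tree contour system, `M` the block torus, `a c m² : ℝ`, `U V` complex link fields):
* §1 ★★ **`kingWoodbury_mul_eq_one`** — THE DUAL WOODBURY IDENTITY, rectangular `X : p × q`, `Y : q × p`: `a ≠ 0`, `A = B + a•(Y*X)`, `A`, `B` invertible ⟹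
  `(a•1 − a²•(X A⁻¹ Y)) * (a⁻¹•1 + X B⁻¹ Y) = 1`; `kingWoodbury_mul_eq_one'` (the other order).
* §2 def **`cxBlockCov T M a c m² U V := a⁻¹·1 + Q(U)·(cxFullOp T M 0 c m² U V)⁻¹·Q♯_K(V)`** (THE CONTINUED BLOCK-FIELD COVARIANCE); `cxFullOp_eq_zero_add_blockTerm` (`A(U,V) = B(U,V) + a·Q♯_K(V)Q(U)`);
  ★★★ **`cxEffLap_mul_cxBlockCov`** (`Δ_eff(U,V)·C(U,V) = 1`), `cxBlockCov_mul_cxEffLap`, ★★★ **`inv_cxEffLap_eq_cxBlockCov`** (`(Δ_eff(U,V))⁻¹ = C(U,V)`), `isUnit_cxEffLap_of_isUnit`, `inv_cxBlockCov_eq_cxEffLap`,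
  `isUnit_cxBlockCov_of_isUnit` — all under `IsUnit A(U,V)`, `IsUnit B(U,V)`, `a ≠ 0`.
* §3 SLICES: `cxFullOp_zero_adjoint_eq_covLapF` (`B(U,Uᴴ) = −cΔ_U + m²`), ★ `cxBlockCov_adjoint` (`C(U,Uᴴ) = a⁻¹1 + Q(U)(−cΔ_U+m²)⁻¹Q(U)^*`, EVERY `U`), ★★ **`cxBlockCov_adjoint_eq_inv_effLapU`**
  (unitary `U`, `a, m² > 0`, `c ≥ 0`: `C(U,Uᴴ) = (Δ_eff(U))⁻¹` — PART Ϥ-k `effLapU_inv_eq_noise_add_blockAvg` BY NAME), ★★ `cxBlockCov_inv_of_unitary` (print's slice `V = U⁻¹`: the same),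
  ★ `cxBlockCov_conjTranspose` (`C(U,V)ᴴ = C(Vᴴ,Uᴴ)`), `cxBlockCov_zero_sandwich` (`C − a⁻¹1` is the `a = 0` sandwich of PART Ϩ-l).
* §4 `blk_cxBlockCov` (`blk C y y′ = a⁻¹[y = y′]·1 + blk (Q(U)B⁻¹Q♯_K(V)) y y′`), `blk_cxBlockCov_sub` (differences of two fields: the noise cancels).
PRIOR TREE ART (by name): Ϩ-a (`cxFullOp`, `cxQadj`, `cxFullOp_adjoint`, `cxFullOp_inv_of_unitary`, `cxFullOp_conjTranspose`, `conjTranspose_cxQadj`, `cxQadj_adjoint`), Ϩ-l (`cxKingQadj`, `cxEffLap`,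
`cxKingQadj_adjoint`), Ϥ-k (`effLapU`, `effLapU_inv_eq_noise_add_blockAvg`, `fullOpU_eq_covLapF_add`), Ϥ-d (`kingQadjU`, `fullOpU`), Mathlib (`mul_eq_one_comm`, `Matrix.inv_eq_right_inv`,
`Matrix.conjTranspose_nonsing_inv`).  Dedup (rg at filing): basename 0 files; needles `cxBlockCov|kingWoodbury` 0 tree files; `woodbury` hits only the real toy
`B9SectCDiffCutModelToy8.woodbury_mul_eq_one` (sum form `(G₀ + G₀UM⁻VG₀)(H − UCV) = 1`, different shape; cited, not imported).  Locators: [King1986] (2.13)–(2.14) p.653, (4.5) p.670,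
(4.44)–(4.45) p.675; [Balaban1985BackgroundPropagators] (3.19) p.393, (3.24)–(3.25) p.394, §3.B p.399 l.37–40, Thm 3.4 p.400; [Balaban1984PropagatorsI] (1.29) p.23.  0 `sorry`, 1 `def`.
-/

noncomputable section
open scoped BigOperators ComplexConjugate ComplexOrder Matrix.Norms.L2Operator
open Finset Matrix

namespace Summit.QuantumFields.YangMills.BalabanUVNodes.N15KingModelRung.Analytic

open Literature.MathematicalPhysics.QuantumFieldTheory.LatticeDiamagneticInequality (blk)
open Literature.MathematicalPhysics.QuantumFieldTheory.Balaban1983to89.B5Prop11Plancherel (Tor fine)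
open Summit.QuantumFields.YangMills.BalabanUVNodes.N15KingModelRung.Covariant (covLapF cxLapF blk_sub' blk_smul' blk_add')
open Summit.QuantumFields.YangMills.BalabanUVNodes.N15KingModelRung.CovariantBlock
  (BlockTree covQ kingQadjU fullOpU effLapU fullOpU_eq_covLapF_add effLapU_inv_eq_noise_add_blockAvg isUnit_effLapU)

/-! ## §1 The dual Woodbury identity -/

section Woodbury

variable {𝕜 : Type*} [Field 𝕜] {p q : Type*} [Fintype p] [DecidableEq p] [Fintype q] [DecidableEq q]

/-- ★★ **THE DUAL WOODBURY IDENTITY** (rectangular `X`, `Y`): if `a ≠ 0`, `A = B + a•(Y*X)` and `A`, `B` are invertible, then `(a•1 − a²•(XA⁻¹Y))·(a⁻¹•1 + XB⁻¹Y) = 1`.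
With `G = A⁻¹`: `G(YX)B⁻¹ = a⁻¹(B⁻¹ − G)`, and the cross terms cancel. [cite: King1986, (4.44)–(4.45) p.675; Balaban1984PropagatorsI, (1.29) p.23] -/
theorem kingWoodbury_mul_eq_one {a : 𝕜} (ha : a ≠ 0) {X : Matrix p q 𝕜} {Y : Matrix q p 𝕜} {A B : Matrix q q 𝕜} (hAB : A = B + a • (Y * X)) (hA : IsUnit A) (hB : IsUnit B) :
    (a • (1 : Matrix p p 𝕜) - (a ^ 2) • (X * A⁻¹ * Y)) * (a⁻¹ • (1 : Matrix p p 𝕜) + X * B⁻¹ * Y) = 1 := by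
  set G := A⁻¹ with hG
  set Mi := B⁻¹ with hMi
  have hGA : G * A = 1 := Matrix.nonsing_inv_mul _ ((Matrix.isUnit_iff_isUnit_det _).mp hA)
  have hBMi : B * Mi = 1 := Matrix.mul_nonsing_inv _ ((Matrix.isUnit_iff_isUnit_det _).mp hB)
  have hYX : Y * X = a⁻¹ • (A - B) := by rw [hAB, add_sub_cancel_left, smul_smul, inv_mul_cancel₀ ha, one_smul]
  have hkey : G * (Y * X) * Mi = a⁻¹ • (Mi - G) := by
    rw [hYX, Matrix.mul_smul, Matrix.smul_mul, Matrix.mul_sub, Matrix.sub_mul, hGA, Matrix.one_mul, Matrix.mul_assoc, hBMi, Matrix.mul_one]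
  have h4 : X * G * Y * (X * Mi * Y) = X * (G * (Y * X) * Mi) * Y := by simp only [Matrix.mul_assoc]
  have e1 : a⁻¹ * a = 1 := inv_mul_cancel₀ ha
  have e2 : a⁻¹ * a ^ 2 = a := by rw [sq, ← mul_assoc, inv_mul_cancel₀ ha, one_mul]
  have e3 : a ^ 2 * a⁻¹ = a := by rw [mul_comm, e2]
  have hexp : (a • (1 : Matrix p p 𝕜) - (a ^ 2) • (X * G * Y)) * (a⁻¹ • (1 : Matrix p p 𝕜) + X * Mi * Y)
      = 1 + a • (X * Mi * Y) - a • (X * G * Y) - (a ^ 2) • (X * (G * (Y * X) * Mi) * Y) := by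
    simp only [Matrix.sub_mul, Matrix.mul_add, Matrix.smul_mul, Matrix.mul_smul, Matrix.one_mul, Matrix.mul_one, smul_sub, smul_smul, e1, e2, one_smul, h4]
    abel
  rw [hexp, hkey, Matrix.mul_smul, Matrix.smul_mul, smul_smul, e3, Matrix.mul_sub, Matrix.sub_mul, smul_sub]
  abel

/-- The dual Woodbury identity in the other order: `(a⁻¹•1 + XB⁻¹Y)·(a•1 − a²•(XA⁻¹Y)) = 1`. [cite: King1986, (4.44)–(4.45) p.675] -/
theorem kingWoodbury_mul_eq_one' {a : 𝕜} (ha : a ≠ 0) {X : Matrix p q 𝕜} {Y : Matrix q p 𝕜} {A B : Matrix q q 𝕜} (hAB : A = B + a • (Y * X)) (hA : IsUnit A) (hB : IsUnit B) :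
    (a⁻¹ • (1 : Matrix p p 𝕜) + X * B⁻¹ * Y) * (a • (1 : Matrix p p 𝕜) - (a ^ 2) • (X * A⁻¹ * Y)) = 1 :=
  mul_eq_one_comm.mp (kingWoodbury_mul_eq_one ha hAB hA hB)

end Woodbury

variable {d : ℕ} {L : ℕ} [NeZero L] (T : BlockTree d L) (M : Fin (d + 1) → ℕ) [hM : ∀ μ, NeZero (M μ)]
variable {𝕜 : Type*} [RCLike 𝕜] {n : Type*} [Fintype n] [DecidableEq n]

/-! ## §2 The continued block-field covariance and the Woodbury inversion of `Δ_eff(U,V)` -/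

section Objects

/-- THE CONTINUED BLOCK-FIELD COVARIANCE (NE2's unit layer at a two-sided complex link field): `C(U,V) = a⁻¹·1 + Q(U)·B(U,V)⁻¹·Q♯_K(V)`, `B(U,V) = −cΔ_{U,V} + m²` (zero block coupling) —
block-spin noise plus the covariant block average of the continued fine covariance. [cite: King1986, (2.14) p.653, (4.44)–(4.45) p.675; Balaban1985BackgroundPropagators, §3.B p.399 l.37–40] -/
def cxBlockCov (a c m2 : ℝ) (U V : Tor (fine L M) × Fin (d + 1) → Matrix n n 𝕜) : Matrix (Tor M × n) (Tor M × n) 𝕜 :=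
  (a⁻¹ : 𝕜) • (1 : Matrix (Tor M × n) (Tor M × n) 𝕜) + covQ T M U * (cxFullOp T M 0 c m2 U V)⁻¹ * cxKingQadj T M V

/-- `A(U,V) = B(U,V) + a·Q♯_K(V)Q(U)` — the block term is `a` times the product of the two continued block maps. [cite: King1986, (2.13) p.653; Balaban1985BackgroundPropagators, (3.24) p.394] -/
theorem cxFullOp_eq_zero_add_blockTerm (a c m2 : ℝ) (U V : Tor (fine L M) × Fin (d + 1) → Matrix n n 𝕜) :
    cxFullOp T M a c m2 U V = cxFullOp T M 0 c m2 U V + (a : 𝕜) • (cxKingQadj T M V * covQ T M U) := by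
  rw [cxFullOp, cxFullOp_zero_blockCoupling, cxKingQadj, Matrix.smul_mul, smul_smul]
  push_cast
  rfl

/-- `C(U,V) − a⁻¹1 = Q(U)·A(U,V)|_{a=0}⁻¹·Q♯_K(V)` — the continued sandwich of PART Ϩ-l AT ZERO BLOCK COUPLING. [cite: King1986, (2.14) p.653, (4.45) p.675] -/
theorem cxBlockCov_zero_sandwich (a c m2 : ℝ) (U V : Tor (fine L M) × Fin (d + 1) → Matrix n n 𝕜) :
    cxBlockCov T M a c m2 U V - (a⁻¹ : 𝕜) • 1 = covQ T M U * (cxFullOp T M 0 c m2 U V)⁻¹ * cxKingQadj T M V := by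
  rw [cxBlockCov, add_sub_cancel_left]

variable {a c m2 : ℝ} {U V : Tor (fine L M) × Fin (d + 1) → Matrix n n 𝕜}

/-- ★★★ **WOODBURY AT A TWO-SIDED COMPLEX LINK FIELD**: `Δ_eff(U,V)·C(U,V) = 1` whenever `A(U,V)` and `B(U,V)` are invertible and `a ≠ 0`.
[cite: King1986, (2.14) p.653, (4.44)–(4.45) p.675; Balaban1985BackgroundPropagators, Thm 3.4 p.400] -/
theorem cxEffLap_mul_cxBlockCov (ha : a ≠ 0) (hA : IsUnit (cxFullOp T M a c m2 U V)) (hB : IsUnit (cxFullOp T M 0 c m2 U V)) :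
    cxEffLap T M a c m2 U V * cxBlockCov T M a c m2 U V = 1 := by
  have ha' : (a : 𝕜) ≠ 0 := by exact_mod_cast ha
  have h := kingWoodbury_mul_eq_one ha' (cxFullOp_eq_zero_add_blockTerm T M a c m2 U V) hA hB
  have e2 : ((a ^ 2 : ℝ) : 𝕜) = (a : 𝕜) ^ 2 := by push_cast; ring
  rw [cxEffLap, cxBlockCov, e2]
  exact h

/-- … and `C(U,V)·Δ_eff(U,V) = 1`. [cite: King1986, (4.44)–(4.45) p.675] -/
theorem cxBlockCov_mul_cxEffLap (ha : a ≠ 0) (hA : IsUnit (cxFullOp T M a c m2 U V)) (hB : IsUnit (cxFullOp T M 0 c m2 U V)) :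
    cxBlockCov T M a c m2 U V * cxEffLap T M a c m2 U V = 1 :=
  mul_eq_one_comm.mp (cxEffLap_mul_cxBlockCov T M ha hA hB)

/-- ★★★ **THE CONTINUED EFFECTIVE LAPLACIAN IS INVERTIBLE WITH INVERSE THE WOODBURY FORM**: `(Δ_eff(U,V))⁻¹ = a⁻¹·1 + Q(U)B(U,V)⁻¹Q♯_K(V)`.
[cite: King1986, (2.14) p.653, (4.44)–(4.45) p.675; Balaban1985BackgroundPropagators, Thm 3.4 p.400] -/
theorem inv_cxEffLap_eq_cxBlockCov (ha : a ≠ 0) (hA : IsUnit (cxFullOp T M a c m2 U V)) (hB : IsUnit (cxFullOp T M 0 c m2 U V)) :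
    (cxEffLap T M a c m2 U V)⁻¹ = cxBlockCov T M a c m2 U V :=
  Matrix.inv_eq_right_inv (cxEffLap_mul_cxBlockCov T M ha hA hB)

/-- `Δ_eff(U,V)` is invertible there. [cite: King1986, (2.14) p.653] -/
theorem isUnit_cxEffLap_of_isUnit (ha : a ≠ 0) (hA : IsUnit (cxFullOp T M a c m2 U V)) (hB : IsUnit (cxFullOp T M 0 c m2 U V)) :
    IsUnit (cxEffLap T M a c m2 U V) :=
  (Matrix.isUnit_iff_isUnit_det _).mpr (Matrix.isUnit_det_of_right_inverse (cxEffLap_mul_cxBlockCov T M ha hA hB))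

/-- `C(U,V)⁻¹ = Δ_eff(U,V)`. [cite: King1986, (2.14) p.653] -/
theorem inv_cxBlockCov_eq_cxEffLap (ha : a ≠ 0) (hA : IsUnit (cxFullOp T M a c m2 U V)) (hB : IsUnit (cxFullOp T M 0 c m2 U V)) :
    (cxBlockCov T M a c m2 U V)⁻¹ = cxEffLap T M a c m2 U V :=
  Matrix.inv_eq_right_inv (cxBlockCov_mul_cxEffLap T M ha hA hB)

/-- `C(U,V)` is invertible there. [cite: King1986, (2.14) p.653] -/
theorem isUnit_cxBlockCov_of_isUnit (ha : a ≠ 0) (hA : IsUnit (cxFullOp T M a c m2 U V)) (hB : IsUnit (cxFullOp T M 0 c m2 U V)) :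
    IsUnit (cxBlockCov T M a c m2 U V) :=
  (Matrix.isUnit_iff_isUnit_det _).mpr (Matrix.isUnit_det_of_right_inverse (cxBlockCov_mul_cxEffLap T M ha hA hB))

end Objects

/-! ## §3 The slices: the adjoint slice (PART Ϥ-k by name) and print's slice -/

section Slices

/-- `B(U,Uᴴ) = −cΔ_U + m²` (PART Ͱ-a's `covLapF`) for EVERY link field `U`. [cite: King1986, (2.13) p.653; Balaban1985BackgroundPropagators, (3.3) p.391] -/
theorem cxFullOp_zero_adjoint_eq_covLapF (c m2 : ℝ) (U : Tor (fine L M) × Fin (d + 1) → Matrix n n 𝕜) :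
    cxFullOp T M 0 c m2 U (fun bd => (U bd)ᴴ) = covLapF (fine L M) c m2 U := by
  rw [cxFullOp_adjoint, fullOpU_eq_covLapF_add]
  push_cast
  rw [zero_smul, add_zero]

/-- `B(U,U⁻¹) = −cΔ_U + m²` on print's slice through a unitary `U`. [cite: Balaban1985BackgroundPropagators, §3.B p.399 l.37–40] -/
theorem cxFullOp_zero_inv_eq_covLapF (c m2 : ℝ) {U : Tor (fine L M) × Fin (d + 1) → Matrix n n 𝕜} (hU : ∀ bd, U bd ∈ Matrix.unitaryGroup n 𝕜) :
    cxFullOp T M 0 c m2 U (fun bd => (U bd)⁻¹) = covLapF (fine L M) c m2 U := by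
  rw [cxFullOp_inv_of_unitary T M 0 c m2 hU, fullOpU_eq_covLapF_add]
  push_cast
  rw [zero_smul, add_zero]

/-- ★ ON THE ADJOINT SLICE: `C(U,Uᴴ) = a⁻¹·1 + Q(U)·(−cΔ_U+m²)⁻¹·Q(U)^*` for EVERY link field `U` — the right-hand side of PART Ϥ-k's Woodbury form. [cite: King1986, (2.14) p.653, (4.45) p.675] -/
theorem cxBlockCov_adjoint (a c m2 : ℝ) (U : Tor (fine L M) × Fin (d + 1) → Matrix n n 𝕜) :
    cxBlockCov T M a c m2 U (fun bd => (U bd)ᴴ) = (a⁻¹ : 𝕜) • 1 + covQ T M U * (covLapF (fine L M) c m2 U)⁻¹ * kingQadjU T M U := by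
  rw [cxBlockCov, cxFullOp_zero_adjoint_eq_covLapF, cxKingQadj_adjoint]

/-- ★★ **ON THE ADJOINT SLICE THROUGH A UNITARY FIELD THE CONTINUED COVARIANCE IS KING's BLOCK-FIELD COVARIANCE**: `C(U,Uᴴ) = (Δ_eff(U))⁻¹` (`a, m² > 0`, `c ≥ 0`) — PART Ϥ-k's
`effLapU_inv_eq_noise_add_blockAvg` by name. [cite: King1986, (2.14) p.653, (4.44)–(4.45) p.675; Balaban1985BackgroundPropagators, (3.25) p.394] -/
theorem cxBlockCov_adjoint_eq_inv_effLapU {a c m2 : ℝ} (ha : 0 < a) (hc : 0 ≤ c) (hm : 0 < m2) {U : Tor (fine L M) × Fin (d + 1) → Matrix n n 𝕜} (hU : ∀ bd, U bd ∈ Matrix.unitaryGroup n 𝕜) :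
    cxBlockCov T M a c m2 U (fun bd => (U bd)ᴴ) = (effLapU T M a c m2 U)⁻¹ := by
  rw [cxBlockCov_adjoint, effLapU_inv_eq_noise_add_blockAvg T M ha hc hm hU]

/-- ★★ **PRINT's SLICE THROUGH A UNITARY FIELD**: `C(U,U⁻¹) = (Δ_eff(U))⁻¹` (`a, m² > 0`, `c ≥ 0`). [cite: King1986, (2.14) p.653; Balaban1985BackgroundPropagators, §3.B p.399 l.37–40] -/
theorem cxBlockCov_inv_of_unitary {a c m2 : ℝ} (ha : 0 < a) (hc : 0 ≤ c) (hm : 0 < m2) {U : Tor (fine L M) × Fin (d + 1) → Matrix n n 𝕜} (hU : ∀ bd, U bd ∈ Matrix.unitaryGroup n 𝕜) :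
    cxBlockCov T M a c m2 U (fun bd => (U bd)⁻¹) = (effLapU T M a c m2 U)⁻¹ := by
  have h : (fun bd => (U bd)⁻¹) = fun bd => (U bd)ᴴ := by
    funext bd
    have h1 : (U bd)ᴴ * U bd = 1 := by simpa only [star_eq_conjTranspose] using Matrix.mem_unitaryGroup_iff'.mp (hU bd)
    exact Matrix.inv_eq_left_inv h1
  rw [h, cxBlockCov_adjoint_eq_inv_effLapU T M ha hc hm hU]

/-- `C(U,Uᴴ) − a⁻¹1 = Q(U)(−cΔ_U+m²)⁻¹Q(U)^*` on the adjoint slice (every `U`). [cite: King1986, (4.45) p.675] -/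
theorem cxBlockCov_adjoint_zero_sandwich (a c m2 : ℝ) (U : Tor (fine L M) × Fin (d + 1) → Matrix n n 𝕜) :
    cxBlockCov T M a c m2 U (fun bd => (U bd)ᴴ) - (a⁻¹ : 𝕜) • 1 = covQ T M U * (fullOpU T M 0 c m2 U)⁻¹ * kingQadjU T M U := by
  rw [cxBlockCov_zero_sandwich, cxFullOp_adjoint, cxKingQadj_adjoint]

omit hM in
/-- `(Q♯_K(V))ᴴ = L^{d+1}·Q(Vᴴ)`. [cite: King1986, (2.13) p.653] -/
theorem conjTranspose_cxKingQadj (V : Tor (fine L M) × Fin (d + 1) → Matrix n n 𝕜) : (cxKingQadj T M V)ᴴ = ((L : 𝕜) ^ (d + 1)) • covQ T M (fun bd => (V bd)ᴴ) := by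
  rw [cxKingQadj, conjTranspose_smul, conjTranspose_cxQadj, RCLike.star_def, map_pow, map_natCast]

omit hM in
/-- `(Q(U))ᴴ = L^{−(d+1)}·Q♯_K(Uᴴ)`. [cite: King1986, (2.13) p.653] -/
theorem conjTranspose_covQ_eq (U : Tor (fine L M) × Fin (d + 1) → Matrix n n 𝕜) : (covQ T M U)ᴴ = ((L : 𝕜) ^ (d + 1))⁻¹ • cxKingQadj T M (fun bd => (U bd)ᴴ) := by
  have hL : ((L : 𝕜) ^ (d + 1)) ≠ 0 := pow_ne_zero _ (by exact_mod_cast NeZero.ne L)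
  rw [cxKingQadj, cxQadj_adjoint, smul_smul, inv_mul_cancel₀ hL, one_smul]

/-- ★ THE ADJOINT OF THE CONTINUED COVARIANCE: `C(U,V)ᴴ = C(Vᴴ,Uᴴ)` (so `C(U,Uᴴ)` is Hermitian for every `U`). [cite: Balaban1985BackgroundPropagators, §3.B p.399 l.37–40] -/
theorem cxBlockCov_conjTranspose (a c m2 : ℝ) (U V : Tor (fine L M) × Fin (d + 1) → Matrix n n 𝕜) :
    (cxBlockCov T M a c m2 U V)ᴴ = cxBlockCov T M a c m2 (fun bd => (V bd)ᴴ) (fun bd => (U bd)ᴴ) := by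
  have hL : ((L : 𝕜) ^ (d + 1)) ≠ 0 := pow_ne_zero _ (by exact_mod_cast NeZero.ne L)
  have hstar : star (a⁻¹ : 𝕜) = (a⁻¹ : 𝕜) := by rw [RCLike.star_def, map_inv₀, RCLike.conj_ofReal]
  rw [cxBlockCov, cxBlockCov, conjTranspose_add, conjTranspose_smul, conjTranspose_one, hstar, conjTranspose_mul, conjTranspose_mul, conjTranspose_nonsing_inv, cxFullOp_conjTranspose,
    conjTranspose_cxKingQadj, conjTranspose_covQ_eq]
  simp only [Matrix.smul_mul, Matrix.mul_smul, smul_smul, inv_mul_cancel₀ hL, one_smul, Matrix.mul_assoc]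

/-- `C(U,Uᴴ)` is Hermitian for every link field `U`. [cite: King1986, (2.14) p.653] -/
theorem isHermitian_cxBlockCov_adjoint (a c m2 : ℝ) (U : Tor (fine L M) × Fin (d + 1) → Matrix n n 𝕜) : (cxBlockCov T M a c m2 U (fun bd => (U bd)ᴴ)).IsHermitian := by
  rw [Matrix.IsHermitian, cxBlockCov_conjTranspose]
  simp only [conjTranspose_conjTranspose]

end Slices

/-! ## §4 The blocks of `C(U,V)` -/

section Blocks

/-- THE FIBRE BLOCKS OF THE CONTINUED COVARIANCE: `blk C(U,V) y y′ = a⁻¹[y = y′]·1 + blk (Q(U)B(U,V)⁻¹Q♯_K(V)) y y′`. [cite: King1986, (2.14) p.653, (4.45) p.675] -/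
theorem blk_cxBlockCov (a c m2 : ℝ) (U V : Tor (fine L M) × Fin (d + 1) → Matrix n n 𝕜) (y y' : Tor M) :
    blk (cxBlockCov T M a c m2 U V) y y' = (if y = y' then (a⁻¹ : 𝕜) else 0) • (1 : Matrix n n 𝕜) + blk (covQ T M U * (cxFullOp T M 0 c m2 U V)⁻¹ * cxKingQadj T M V) y y' := by
  ext i i'
  simp only [cxBlockCov, blk, Matrix.of_apply, Matrix.add_apply, Matrix.smul_apply, Matrix.one_apply, Prod.mk.injEq, smul_eq_mul]
  by_cases h : y = y' <;> by_cases h' : i = i' <;> simp [h, h']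

/-- THE NOISE CANCELS IN DIFFERENCES: `blk (C(U,V) − C(U′,V′)) y y′ = blk (Q(U)B(U,V)⁻¹Q♯_K(V) − Q(U′)B(U′,V′)⁻¹Q♯_K(V′)) y y′`. [cite: King1986, (4.45) p.675] -/
theorem blk_cxBlockCov_sub (a c m2 : ℝ) (U V U' V' : Tor (fine L M) × Fin (d + 1) → Matrix n n 𝕜) (y y' : Tor M) :
    blk (cxBlockCov T M a c m2 U V - cxBlockCov T M a c m2 U' V') y y'
      = blk (covQ T M U * (cxFullOp T M 0 c m2 U V)⁻¹ * cxKingQadj T M V - covQ T M U' * (cxFullOp T M 0 c m2 U' V')⁻¹ * cxKingQadj T M V') y y' := by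
  congr 1
  rw [cxBlockCov, cxBlockCov]
  abel

/-- The off-diagonal blocks carry no noise: `y ≠ y′` ⟹ `blk C(U,V) y y′ = blk (Q(U)B⁻¹Q♯_K(V)) y y′`. [cite: King1986, (4.45) p.675] -/
theorem blk_cxBlockCov_of_ne (a c m2 : ℝ) (U V : Tor (fine L M) × Fin (d + 1) → Matrix n n 𝕜) {y y' : Tor M} (h : y ≠ y') :
    blk (cxBlockCov T M a c m2 U V) y y' = blk (covQ T M U * (cxFullOp T M 0 c m2 U V)⁻¹ * cxKingQadj T M V) y y' := by
  rw [blk_cxBlockCov, if_neg h, zero_smul, zero_add]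

end Blocks

end Summit.QuantumFields.YangMills.BalabanUVNodes.N15KingModelRung.Analytic

end
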